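import Summits.Ventures.PercRepro.Night2LocalD2TwoPair
import Summits.Ventures.PercRepro.Night2LocalD2FarCount

/-!
# PercRepro — the (6,4) cell `|E ∖ G| = 2` without a coloop-carrying hyperplane: the pair-5 certificate when no
4-set `C ⊆ G` has `ρ(G ∖ C) ≤ 2` (night-2, gen 15; THEOREM D of NIGHT-2-k0.md)

**`localShadowHall_d2_of_no_four`** — `G ∈ flatsQ M 5`, `|E ∖ G| = 2`, every member below `G` has `|G ∖ cl B| ≥ 2`,
and every `C ⊆ G` with `|C| ≤ 4` has `ρ(G ∖ C) ≥ 3` ⟹ `LocalShadowHall M 4 G`.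

Rule = the pair-5 rule `opW` (Night2LocalD2OnePairDefs).  Columns at a shadow set `S` with `κ₀` coloops,
`c ≤ κ₀` covering preimages, `P' := #pairPre S ≤ #seriesPairs S` (`2P' ≤ (6−κ₀)(5−κ₀)`) and `f := #opFarPre S` far
preimages: the column is `≤ c/5 + (P' − f)/25 + f/5`, and
* `f ≤ 1`: `5κ₀ + P' + 4f ≤ 25` (the arithmetic of Night2LocalD2OnePair);
* `f = 2`: no covering preimage (`coverPreimages_eq_empty_of_two_far`), `P' ≤ 15`: `≤ 23/25`;
* `f = 3`: no covering preimage and `P' ≤ 12` (`card_pairPre_le_twelve_of_three_far`): `≤ 24/25`;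
* `f ≥ 4` is impossible (`card_opFarPre_le_three`).
-/

namespace PercRepro.Shadow

open Finset PerFlat ThmH

variable {α : Type*} [DecidableEq α] {M : Matroid α} [M.Finite]

/-- The arithmetic of the column with `f ≤ 3` far preimages: `c/5 + (P − f)/25 + f/5 ≤ 1` when `c ≤ a ≤ 5`,
`2P ≤ (6−a)(5−a)`, `f ≤ 3`, `f ≤ P`, `2 ≤ f → c = 0` and `f = 3 → P ≤ 12`. -/
theorem nf_col_arith {a c P f : ℕ} (ha : a ≤ 5) (hc : c ≤ a) (hP : 2 * P ≤ (4 + 2 - a) * (4 + 1 - a))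
    (hf : f ≤ 3) (hfP : f ≤ P) (hf2 : 2 ≤ f → c = 0) (hf3 : f = 3 → P ≤ 12) :
    (c : ℚ) * (1 / 5) + ((P : ℚ) - (f : ℚ)) * (1 / 25) + (f : ℚ) * (1 / 5) ≤ 1 := by
  have hnat : 5 * c + P + 4 * f ≤ 25 := by
    interval_cases f
    · interval_cases a <;> omega
    · interval_cases a <;> omega
    · have hc0 := hf2 (by norm_num)
      subst hc0
      interval_cases a <;> omega
    · have hc0 := hf2 (by norm_num)
      have hP12 := hf3 rfl
      subst hc0
      omega
  have hq : ((5 * c + P + 4 * f : ℕ) : ℚ) ≤ 25 := by exact_mod_cast hnat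
  push_cast at hq
  linarith

open scoped Classical in
/-- Three far preimages bound the pair preimages by `12`. -/
theorem card_pairPre_le_twelve_of_card_opFarPre {G : Finset α} (hG : G ∈ flatsQ M (4 + 1))
    (hd : (gr M \ G).card = 2) (h4 : ∀ C ⊆ G, C.card ≤ 4 → 3 ≤ rkN M (G \ C))
    {S : Finset α} (hS : S ∈ shadowAt M (4 + 2) 4 (Uq M (4 + 2) 4) G) (h3 : (opFarPre M G S).card = 3) :
    (pairPre M 4 G S).card ≤ 12 := by
  obtain ⟨B₁, h₁, B₂, h₂, B₃, h₃, h₁₂, h₁₃, h₂₃⟩ := Finset.two_lt_card.1 (by omega : 2 < (opFarPre M G S).card)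
  exact card_pairPre_le_twelve_of_three_far hG hd h4 hS h₁ h₂ h₃ h₁₂ h₁₃ h₂₃

open scoped Classical in
/-- **The column bound** of the pair-5 rule when no `C ⊆ G` with `|C| ≤ 4` has `ρ(G ∖ C) ≤ 2`. -/
theorem sum_opW_col_le_no_four {G : Finset α} (hG : G ∈ flatsQ M (4 + 1)) (hd : (gr M \ G).card = 2)
    (h4 : ∀ C ⊆ G, C.card ≤ 4 → 3 ≤ rkN M (G \ C))
    {S : Finset α} (hS : S ∈ shadowAt M (4 + 2) 4 (Uq M (4 + 2) 4) G) :
    ∑ B ∈ membersIn M (Uq M (4 + 2) 4) G, opW M G B S ≤ 1 := by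
  have hGg : G ⊆ gr M := (mem_flatsQ.1 hG).1
  have hc : ∀ B ∈ membersIn M (Uq M (4 + 2) 4) G, (gr M \ clF M B).card = (G \ clF M B).card + 2 := by
    intro B hB
    rw [card_sdiff_clF_eq_add hGg (mem_membersIn.1 hB).2, hd]
  have hSG : S ⊆ G := subset_of_mem_shadowAt hS
  have hSE : S ⊆ gr M := hSG.trans hGg
  have hSY : S ∈ Yq M (4 + 2) 4 := shadow_subset_Yq _ (mem_shadowAt.1 hS).1
  have hSr : rkN M S = 4 + 1 := by
    unfold rkN; rw [eRk_eq_of_mem_Yq_diag hSY]; rfl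
  have hcol : (coloops M S).card ≤ 4 + 1 := card_coloops_le hSE (eRk_eq_of_mem_Yq_diag hSY)
  have hP := two_mul_card_seriesPairs_le hSE hSr
  have hpp := card_pairPre_le hG hS
  have hfar := card_opFarPre_le_three hG hd h4 S
  have hfp : (opFarPre M G S).card ≤ (pairPre M 4 G S).card :=
    Finset.card_le_card (opFarPre_subset_pairPre G S)
  have hcpre : (coverPreimages M (Uq M (4 + 2) 4) G S).card ≤ (coloops M S).card :=
    card_coverPreimages_le_card_coloops (le_refl _) G S
  have hf2 : 2 ≤ (opFarPre M G S).card → (coverPreimages M (Uq M (4 + 2) 4) G S).card = 0 := by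
    intro h
    rw [coverPreimages_eq_empty_of_card_opFarPre hG hd h]
    rfl
  have hf3 : (opFarPre M G S).card = 3 → (pairPre M 4 G S).card ≤ 12 :=
    card_pairPre_le_twelve_of_card_opFarPre hG hd h4 hS
  unfold opW
  rw [Finset.sum_add_distrib, Finset.sum_add_distrib, sum_opW_cov_col, sum_opFar_col]
  have hcov : ∑ B ∈ coverPreimages M (Uq M (4 + 2) 4) G S, opCov M G B ≤
      ((coverPreimages M (Uq M (4 + 2) 4) G S).card : ℚ) * (1 / 5) := by
    calc ∑ B ∈ coverPreimages M (Uq M (4 + 2) 4) G S, opCov M G B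
        ≤ ∑ B ∈ coverPreimages M (Uq M (4 + 2) 4) G S, (1 / 5 : ℚ) := by
          apply Finset.sum_le_sum
          intro B hB
          exact opCov_le (hc B (mem_coverPreimages.1 hB).1)
      _ = ((coverPreimages M (Uq M (4 + 2) 4) G S).card : ℚ) * (1 / 5) := by
          rw [Finset.sum_const, nsmul_eq_mul]
  have hpair := sum_opW_pair_col_le hc S
  have harith := nf_col_arith (a := (coloops M S).card) (c := (coverPreimages M (Uq M (4 + 2) 4) G S).card)
    (P := (pairPre M 4 G S).card) (f := (opFarPre M G S).card) hcol hcpre (by omega) hfar hfp hf2 hf3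
  calc _ ≤ ((coverPreimages M (Uq M (4 + 2) 4) G S).card : ℚ) * (1 / 5) +
      (((pairPre M 4 G S).card : ℚ) - ((opFarPre M G S).card : ℚ)) * (1 / 25) +
      ((opFarPre M G S).card : ℚ) * (1 / 5) := add_le_add (add_le_add hcov hpair) (le_refl _)
    _ ≤ 1 := harith

open scoped Classical in
/-- **THEOREM D — the (6,4) cell `|E ∖ G| = 2` without a 4-set `C` of `ρ(G ∖ C) ≤ 2`.**  `G ∈ flatsQ M 5`,
`|E ∖ G| = 2`, every member below `G` has `|G ∖ cl B| ≥ 2`, and every `C ⊆ G` with `|C| ≤ 4` has `ρ(G ∖ C) ≥ 3`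
⟹ (LI_G). -/
theorem localShadowHall_d2_of_no_four {G : Finset α} (hG : G ∈ flatsQ M (4 + 1))
    (hd : (gr M \ G).card = 2)
    (hm2 : ∀ B ∈ membersIn M (Uq M (4 + 2) 4) G, 2 ≤ (G \ clF M B).card)
    (h4 : ∀ C ⊆ G, C.card ≤ 4 → 3 ≤ rkN M (G \ C)) :
    LocalShadowHall M 4 G := by
  have hGg : G ⊆ gr M := (mem_flatsQ.1 hG).1
  have hc : ∀ B ∈ membersIn M (Uq M (4 + 2) 4) G, (gr M \ clF M B).card = (G \ clF M B).card + 2 := by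
    intro B hB
    rw [card_sdiff_clF_eq_add hGg (mem_membersIn.1 hB).2, hd]
  apply localShadowHall_of_full_matching (opW M G)
  · intro B S
    exact opW_nonneg G B S
  · intro B S h
    unfold opW at h
    by_cases h1 : (if B ∈ membersIn M (Uq M (4 + 2) 4) G ∧ S ∈ coverSets M B G then opCov M G B else 0) = 0
    · by_cases h2 : (if B ∈ membersIn M (Uq M (4 + 2) 4) G then
          ∑ P ∈ Finset.powersetCard 2 (G \ clF M B), (if S = B ∪ P then cpPair M 4 G B else 0) else 0) = 0
      · rw [h1, h2, zero_add, zero_add] at h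
        split_ifs at h with hB
        · unfold opFar at h
          split_ifs at h with hf
          · rw [hf.2]; exact Finset.subset_union_left
          · exact absurd rfl h
        · exact absurd rfl h
      · split_ifs at h2 with hB
        · obtain ⟨P, hP, hne⟩ := Finset.exists_ne_zero_of_sum_ne_zero h2
          split_ifs at hne with hSP
          · rw [hSP]; exact Finset.subset_union_left
          · exact absurd rfl hne
        · exact absurd rfl h2
    · split_ifs at h1 with hcv
      · obtain ⟨z, -, rfl⟩ := mem_coverSets.1 hcv.2
        exact Finset.subset_insert _ _
      · exact absurd rfl h1
  · intro S hS
    exact sum_opW_col_le_no_four hG hd h4 hS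
  · intro B hB
    exact row_opW_ge hG hB (hc B hB) (hm2 B hB)

end PercRepro.Shadow
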